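import Mathlib
import Literature.Geometry.Symplectic.JHolomorphicCuspDoublePointsDesign
import Literature.Geometry.Symplectic.JHolomorphicCriticalPointsIsolated
import HarnessLib

/-!
# Double points of perturbed cusps, IV: push-off fields from an almost complex structure

Fourth file of the flat-model proof of D. McDuff's theorem that `C¹`-small `J`-holomorphic
immersed perturbations of a cuspidal `J`-holomorphic disc have double points (D. McDuff, *The
local behaviour of holomorphic curves in almost complex 4-manifolds*, J. Differential Geom. 34
(1991), Thm 1.4 with Cor. 4.4 and (5.6); plan in `JHolomorphicCuspDoublePointsDesign.lean`,
degree argument in `JHolomorphicCuspDoublePoints.lean`). The degree argument needs, for the cusp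
and for each perturbation `g`, a continuous push-off field nowhere tangent to the curve; for a
`J`-curve the tangent planes are `J`-complex lines, and a never-tangent field is a nowhere zero
section of the complex normal bundle (McDuff 1991, proof of Thm 4.7, the section `νₙ`). This
file constructs such fields by linear algebra, uniformly in the complex structure:

* `exists_adaptedFrame` — complex coordinates `ψ` for a linear complex structure `J₀` on `ℂ × ℂ`
  preserving the horizontal line, with `ψ J₀ = i ψ` and `ψ(ℂ × 0) ⊆ ℂ × 0`.
* `exists_pushoffSelector` — the rule `E(Jₓ, v) = Aₓ⁻¹ ψ⁻¹ ((ψ Aₓ v)^⊥)`, `Aₓ = ½(1 - J₀ Jₓ)`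
  (which intertwines `Jₓ` with `J₀`), `a^⊥ = (-ā₂, ā₁)`: never in the `Jₓ`-line of `v`,
  continuous, real-homogeneous, and uniformly modelled on nearly horizontal vectors by a fixed
  real-linear map `v₁ ↦ (G₁ v₁, G₂ v₁)` with `G₂` injective.
* `natAbs_wind_comp_realLinear` — injective real-linear maps of `ℂ` preserve `|wind|` (Rouché
  against the dominant one of `α z`, `β z̄`); used to see that the second component of the
  push-off field of the cusp `(wᵏ, û)` winds `±(k-1)` times.

Everything is proved; there are no definitions and no named facts.

## References

* D. McDuff, *The local behaviour of holomorphic curves in almost complex 4-manifolds*,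
  J. Differential Geom. 34 (1991) 143–164, Thm 1.4, §4 (proof of Thm 4.7).
  [McDuff1991LocalBehaviour]
* C. Wendl, *Lectures on Contact 3-Manifolds, Holomorphic Curves and Intersection Theory*,
  Cambridge Tracts in Math. 220 (2020), App. B. [Wendl2020]
-/

noncomputable section

open scoped Real ComplexConjugate Topology
open Complex Set Filter Metric Literature.Topology.PlaneTopology

namespace Literature.Geometry.Symplectic

namespace CuspDoublePoints

/-! ### Linear algebra of the Hermitian-orthogonal direction -/

/-- The Hermitian-orthogonal direction `(-ā₂, ā₁)` of `a = (a₁, a₂) ∈ ℂ²` is never a complex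
multiple of `a` unless `a = 0`. [folklore] -/
theorem eq_zero_of_perp_eq_smul (a : ℂ × ℂ) (c : ℂ)
    (h : ((-conj a.2, conj a.1) : ℂ × ℂ) = c • a) : a = 0 := by
  have h1 : -conj a.2 = c * a.1 := by simpa using congrArg Prod.fst h
  have h2 : conj a.1 = c * a.2 := by simpa using congrArg Prod.snd h
  -- `|a₁|² + |a₂|² = 0`
  have h3 : (normSq a.1 : ℂ) + normSq a.2 = 0 := by
    rw [normSq_eq_conj_mul_self, normSq_eq_conj_mul_self, h2]
    have : conj a.2 = -(c * a.1) := by rw [← h1, neg_neg]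
    rw [this]; ring
  have h4 : normSq a.1 + normSq a.2 = 0 := by exact_mod_cast h3
  have h5 : normSq a.1 = 0 := by nlinarith [normSq_nonneg a.1, normSq_nonneg a.2]
  have h6 : normSq a.2 = 0 := by nlinarith [normSq_nonneg a.1, normSq_nonneg a.2]
  exact Prod.ext (normSq_eq_zero.1 h5) (normSq_eq_zero.1 h6)

/-- `(-ā₂, ā₁)` scales anti-linearly. [folklore] -/
theorem perp_smul (c : ℂ) (a : ℂ × ℂ) :
    ((-conj (c • a).2, conj (c • a).1) : ℂ × ℂ) = conj c • ((-conj a.2, conj a.1) : ℂ × ℂ) := by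
  ext <;> simp [map_mul]

/-- A vector `b` outside the horizontal line `ℂ × {0}`, which is invariant under the complex
structure `J₀`, spans together with `J₀ b` a complement of it: `c b + d J₀ b` is horizontal
only for `c = d = 0`. [folklore] -/
theorem eq_zero_of_horizontal (J₀ : (ℂ × ℂ) →L[ℝ] (ℂ × ℂ)) (hJ₀ : ∀ v, J₀ (J₀ v) = -v)
    (hH : ∀ x : ℂ, (J₀ (x, 0)).2 = 0) {c d : ℝ}
    (h : (c • ((0, 1) : ℂ × ℂ) + d • J₀ (0, 1)).2 = 0) : c = 0 ∧ d = 0 := by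
  by_cases hd : d = 0
  · rw [hd, zero_smul, add_zero] at h
    simp at h
    exact ⟨h, hd⟩
  · exfalso
    -- `q := J₀ (0,1)` has real second component `-c/d`; decompose `q` into its horizontal part
    -- and `Re(q₂) (0,1)`, apply `J₀` and read off the second component: `-1 = (c/d)²`.
    set q : ℂ × ℂ := J₀ (0, 1) with hq
    have hcd : (c : ℂ) + (d : ℂ) * q.2 = 0 := by simpa using h
    have him : q.2.im = 0 := by
      have := congrArg Complex.im hcd
      simp only [add_im, ofReal_im, mul_im, ofReal_re, zero_mul, add_zero, zero_add, zero_im,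
        mul_eq_zero] at this
      rcases this with h' | h'
      · exact absurd h' hd
      · exact h'
    have hq2 : q.2 = (q.2.re : ℂ) := Complex.ext (by simp) (by simp [him])
    have hsplit : q = ((q.1, 0) : ℂ × ℂ) + (q.2.re : ℝ) • ((0, 1) : ℂ × ℂ) := by
      ext
      · simp
      · simp only [Prod.snd_add, Prod.smul_snd, real_smul, mul_one, zero_add]
        exact hq2
    have hJq : J₀ q = -(0, 1) := by rw [hq, hJ₀]
    have h2 := congrArg Prod.snd (congrArg J₀ hsplit)
    rw [hJq, map_add, map_smul, Prod.snd_add, Prod.smul_snd, hH, zero_add] at h2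
    have h3 : (-1 : ℂ) = (q.2.re : ℝ) • q.2 := by simpa using h2
    have h4 : (-1 : ℝ) = q.2.re * q.2.re := by
      have := congrArg Complex.re h3
      simpa [him] using this
    nlinarith [mul_self_nonneg q.2.re]

/-! ### A complex frame adapted to the horizontal line -/

/-- **Adapted complex coordinates.** For a complex structure `J₀` on `ℂ × ℂ` (real-linear,
`J₀² = -1`) preserving the horizontal line `ℂ × {0}` there is a real-linear automorphism `ψ`
with `ψ ∘ J₀ = i ψ` which maps the horizontal line into itself (namely the inverse of
`(a₁, a₂) ↦ Re a₁ (1,0) + Im a₁ J₀(1,0) + Re a₂ (0,1) + Im a₂ J₀(0,1)`). [folklore] -/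
theorem exists_adaptedFrame (J₀ : (ℂ × ℂ) →L[ℝ] (ℂ × ℂ)) (hJ₀ : ∀ v, J₀ (J₀ v) = -v)
    (hH : ∀ x : ℂ, (J₀ (x, 0)).2 = 0) :
    ∃ ψ : (ℂ × ℂ) ≃L[ℝ] (ℂ × ℂ), (∀ v, ψ (J₀ v) = I • ψ v) ∧ (∀ x : ℂ, (ψ (x, 0)).2 = 0) ∧
      (∀ y : ℂ, ψ.symm (0, y) = (y.re : ℝ) • ((0, 1) : ℂ × ℂ) + (y.im : ℝ) • J₀ (0, 1)) := by
  -- the candidate inverse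
  set φ : (ℂ × ℂ) →L[ℝ] (ℂ × ℂ) :=
    (reCLM.comp (ContinuousLinearMap.fst ℝ ℂ ℂ)).smulRight ((1, 0) : ℂ × ℂ) +
    (imCLM.comp (ContinuousLinearMap.fst ℝ ℂ ℂ)).smulRight (J₀ (1, 0)) +
    (reCLM.comp (ContinuousLinearMap.snd ℝ ℂ ℂ)).smulRight ((0, 1) : ℂ × ℂ) +
    (imCLM.comp (ContinuousLinearMap.snd ℝ ℂ ℂ)).smulRight (J₀ (0, 1)) with hφ
  have hφapp : ∀ a : ℂ × ℂ, φ a = (a.1.re : ℝ) • ((1, 0) : ℂ × ℂ) + (a.1.im : ℝ) • J₀ (1, 0) +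
      (a.2.re : ℝ) • ((0, 1) : ℂ × ℂ) + (a.2.im : ℝ) • J₀ (0, 1) := by
    intro a; simp [hφ]
  -- `φ ∘ i = J₀ ∘ φ`
  have hφI : ∀ a : ℂ × ℂ, φ (I • a) = J₀ (φ a) := by
    intro a
    rw [hφapp, hφapp, map_add, map_add, map_add, map_smul, map_smul, map_smul, map_smul, hJ₀, hJ₀]
    simp only [Prod.smul_fst, Prod.smul_snd, smul_eq_mul, mul_re, I_re, zero_mul, I_im, one_mul,
      zero_sub, mul_im, neg_smul, smul_neg]
    abel
  -- horizontality of the first two frame vectors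
  have hhor : ∀ a₁ : ℂ, ((a₁.re : ℝ) • ((1, 0) : ℂ × ℂ) + (a₁.im : ℝ) • J₀ (1, 0)).2 = 0 := by
    intro a₁; simp [hH]
  -- injectivity
  have hφinj : Function.Injective φ := by
    refine (injective_iff_map_eq_zero φ).2 fun a ha => ?_
    rw [hφapp] at ha
    have h2 := congrArg Prod.snd ha
    rw [Prod.snd_add, Prod.snd_add, Prod.snd_zero] at h2
    rw [hhor a.1, zero_add, ← Prod.snd_add] at h2
    obtain ⟨hre, him⟩ := eq_zero_of_horizontal J₀ hJ₀ hH h2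
    rw [hre, him, zero_smul, zero_smul, add_zero, add_zero] at ha
    -- now `Re a₁ (1,0) + Im a₁ J₀ (1,0) = 0`
    have h1 : (1, 0) ≠ (0 : ℂ × ℂ) := by simp
    obtain ⟨hre', him'⟩ := CriticalPoints.eq_zero_of_smul_add_smul_eq_zero J₀ hJ₀ h1 ha
    refine Prod.ext (Complex.ext ?_ ?_) (Complex.ext ?_ ?_) <;> simp_all
  -- the equivalence
  set Lφ : (ℂ × ℂ) ≃ₗ[ℝ] (ℂ × ℂ) := LinearEquiv.ofInjectiveEndo (φ : (ℂ × ℂ) →ₗ[ℝ] (ℂ × ℂ)) hφinj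
    with hLφ
  set ψ : (ℂ × ℂ) ≃L[ℝ] (ℂ × ℂ) := Lφ.symm.toContinuousLinearEquiv with hψ
  have hψsymm : ∀ a, ψ.symm a = φ a := fun a => rfl
  have hψφ : ∀ a, ψ (φ a) = a := fun a => by
    rw [← hψsymm]; exact ψ.apply_symm_apply a
  have hφψ : ∀ v, φ (ψ v) = v := fun v => by
    rw [← hψsymm]; exact ψ.symm_apply_apply v
  refine ⟨ψ, fun v => ?_, fun x => ?_, fun y => ?_⟩
  · -- `ψ (J₀ v) = i ψ v`: apply the injective `φ`
    apply hφinj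
    rw [hφψ, hφI, hφψ]
  · -- horizontal vectors have horizontal coordinates
    set a := ψ (x, 0) with ha
    have h1 : φ a = (x, 0) := by rw [ha, hφψ]
    rw [hφapp] at h1
    have h2 := congrArg Prod.snd h1
    rw [Prod.snd_add, Prod.snd_add] at h2
    rw [hhor a.1, zero_add, ← Prod.snd_add] at h2
    obtain ⟨hre, him⟩ := eq_zero_of_horizontal J₀ hJ₀ hH (by simpa using h2)
    exact Complex.ext (by simpa using hre) (by simpa using him)
  · rw [hψsymm, hφapp]; simp

/-! ### The push-off selector -/

/-- An `ℝ`-linear map `f : ℂ → ℂ × ℂ` commuting with `i` is `ℂ`-linear: `f c = c • f 1`.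
[folklore] -/
theorem apply_eq_smul_apply_one {f : ℂ →ₗ[ℝ] (ℂ × ℂ)} (hf : ∀ c : ℂ, f (I * c) = I • f c) (c : ℂ) :
    f c = c • f 1 := by
  have e : c = (c.re : ℝ) • (1 : ℂ) + (c.im : ℝ) • (I * 1) := by
    simp only [real_smul, mul_one]; exact (re_add_im c).symm
  conv_lhs => rw [e]
  rw [map_add, map_smul, map_smul, hf]
  rw [show (c.re : ℝ) • f 1 + (c.im : ℝ) • I • f 1 = ((c.re : ℂ) + (c.im : ℂ) * I) • f 1 by
    rw [add_smul, mul_smul, Complex.coe_smul, Complex.coe_smul], re_add_im]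

/-- **The push-off selector** (complex-normal field). Let `J₀` be a complex structure on
`ℂ × ℂ` preserving the horizontal line. There is a rule `E` assigning to a complex structure
`Jₓ` near `J₀` and a vector `v` a vector `E(Jₓ, v)` — namely
`E(Jₓ, v) = Aₓ⁻¹ ψ⁻¹ ((ψ Aₓ v)^⊥)` with `Aₓ = ½(1 - J₀ Jₓ)` (so `Aₓ Jₓ = J₀ Aₓ`), `ψ` an adapted
`J₀`-complex frame and `a^⊥ = (-ā₂, ā₁)` — such that: `E(Jₓ, v)` is never in the `Jₓ`-complex
line through `v ≠ 0` (stated for lines given as ranges of `i`-`Jₓ`-intertwining real-linear maps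
`L : ℂ → ℂ × ℂ`); `E` is continuous and real-homogeneous in `v`; and on nearly horizontal
vectors and for `Jₓ` near `J₀` it is uniformly approximated by a fixed real-linear model
`v ↦ (G₁ v₁, G₂ v₁)` with `G₂` injective (cf. the nowhere vanishing section `νₙ` of the
complex normal bundle in McDuff's proof of Thm 4.7).
[cite: McDuff1991LocalBehaviour, §4, proof of Thm 4.7] -/
theorem exists_pushoffSelector (J₀ : (ℂ × ℂ) →L[ℝ] (ℂ × ℂ)) (hJ₀ : ∀ v, J₀ (J₀ v) = -v)
    (hH : ∀ x : ℂ, (J₀ (x, 0)).2 = 0) :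
    ∃ (E : ((ℂ × ℂ) →L[ℝ] (ℂ × ℂ)) → (ℂ × ℂ) → (ℂ × ℂ)) (G₁ G₂ : ℂ →L[ℝ] ℂ) (t₀ : ℝ), 0 < t₀ ∧
      Function.Injective G₂ ∧
      (∀ Jx : (ℂ × ℂ) →L[ℝ] (ℂ × ℂ), ‖Jx - J₀‖ ≤ t₀ → (∀ v, Jx (Jx v) = -v) →
        ∀ (L : ℂ →L[ℝ] (ℂ × ℂ)) (c₀ : ℂ), (∀ c : ℂ, L (I * c) = Jx (L c)) → L c₀ ≠ 0 →
          E Jx (L c₀) ∉ LinearMap.range (L : ℂ →ₗ[ℝ] ℂ × ℂ)) ∧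
      ContinuousOn (fun p : ((ℂ × ℂ) →L[ℝ] (ℂ × ℂ)) × (ℂ × ℂ) => E p.1 p.2)
        (closedBall J₀ t₀ ×ˢ univ) ∧
      (∀ Jx v (r : ℝ), E Jx (r • v) = r • E Jx v) ∧
      (∀ ε > 0, ∃ δ > 0, ∀ Jx : (ℂ × ℂ) →L[ℝ] (ℂ × ℂ), ‖Jx - J₀‖ ≤ δ → ∀ v : ℂ × ℂ,
        ‖v.2‖ ≤ δ * ‖v.1‖ → ‖E Jx v - (G₁ v.1, G₂ v.1)‖ ≤ ε * ‖v.1‖) := by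
  obtain ⟨ψ, hψJ, hψH, hψsymm⟩ := exists_adaptedFrame J₀ hJ₀ hH
  -- ### the objects
  set A : ((ℂ × ℂ) →L[ℝ] (ℂ × ℂ)) → ((ℂ × ℂ) →L[ℝ] (ℂ × ℂ)) :=
    fun Jx => (2 : ℝ)⁻¹ • (1 - J₀.comp Jx) with hA
  set P : ℂ × ℂ → ℂ × ℂ := fun a => (-conj a.2, conj a.1) with hP
  set E : ((ℂ × ℂ) →L[ℝ] (ℂ × ℂ)) → (ℂ × ℂ) → (ℂ × ℂ) :=
    fun Jx v => Ring.inverse (A Jx) (ψ.symm (P (ψ (A Jx v)))) with hE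
  set q : ℂ × ℂ := J₀ (0, 1) with hq
  set m : ℂ →L[ℝ] ℂ := (ContinuousLinearMap.fst ℝ ℂ ℂ).comp
    ((ψ : (ℂ × ℂ) →L[ℝ] (ℂ × ℂ)).comp (ContinuousLinearMap.inl ℝ ℂ ℂ)) with hm
  have hmapp : ∀ x : ℂ, m x = (ψ (x, 0)).1 := fun x => rfl
  set G₁ : ℂ →L[ℝ] ℂ := (imCLM.comp m).smulRight (-q.1) with hG₁
  set G₂ : ℂ →L[ℝ] ℂ := (reCLM.comp m).smulRight (1 : ℂ) + (imCLM.comp m).smulRight (-q.2) with hG₂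
  have hG₁app : ∀ x : ℂ, G₁ x = ((m x).im : ℝ) • (-q.1) := fun x => by simp [hG₁]
  have hG₂app : ∀ x : ℂ, G₂ x = ((m x).re : ℂ) + ((m x).im : ℝ) • (-q.2) := fun x => by
    simp [hG₂]
  -- ### basic identities
  have hψx0 : ∀ x : ℂ, ψ (x, 0) = ((m x, 0) : ℂ × ℂ) := fun x =>
    Prod.ext rfl (hψH x)
  have hP_smul : ∀ (c : ℂ) (a : ℂ × ℂ), P (c • a) = conj c • P a := fun c a => perp_smul c a
  have hP_real : ∀ (r : ℝ) (a : ℂ × ℂ), P (r • a) = r • P a := fun r a => by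
    have := hP_smul (r : ℂ) a
    rwa [Complex.coe_smul, conj_ofReal, Complex.coe_smul] at this
  -- the model: `E` at `J₀` on horizontal vectors
  have hmodel : ∀ x : ℂ, ψ.symm (P (ψ (x, 0))) = ((G₁ x, G₂ x) : ℂ × ℂ) := by
    intro x
    rw [hψx0]
    simp only [hP, neg_zero, map_zero]
    rw [hψsymm, hG₁app, hG₂app]
    ext
    · simp
    · simp
  -- `A J₀ = 1`
  have hAJ₀ : A J₀ = 1 := by
    ext v <;> simp [hA, hJ₀] <;> ring
  -- the commutation relation `A Jx ∘ Jx = J₀ ∘ A Jx`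
  have hcomm : ∀ Jx : (ℂ × ℂ) →L[ℝ] (ℂ × ℂ), (∀ v, Jx (Jx v) = -v) →
      ∀ v, A Jx (Jx v) = J₀ (A Jx v) := by
    intro Jx hJx v
    change (2 : ℝ)⁻¹ • (Jx v - J₀ (Jx (Jx v))) = J₀ ((2 : ℝ)⁻¹ • (v - J₀ (Jx v)))
    rw [hJx, map_neg, map_smul, map_sub, hJ₀]
    congr 1; abel
  -- ### units
  have hAc : Continuous A := by
    have h1 : Continuous fun Jx : (ℂ × ℂ) →L[ℝ] (ℂ × ℂ) => J₀.comp Jx :=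
      Continuous.clm_comp continuous_const continuous_id
    exact (continuous_const.sub h1).const_smul ((2 : ℝ)⁻¹)
  obtain ⟨t₀, ht₀, hunit⟩ : ∃ t₀ > 0, ∀ Jx, ‖Jx - J₀‖ ≤ t₀ → IsUnit (A Jx) := by
    have hopen : IsOpen {x : (ℂ × ℂ) →L[ℝ] (ℂ × ℂ) | IsUnit x} := Units.isOpen
    have hmem : {Jx : (ℂ × ℂ) →L[ℝ] (ℂ × ℂ) | IsUnit (A Jx)} ∈ 𝓝 J₀ := by
      refine hAc.continuousAt.preimage_mem_nhds (hopen.mem_nhds ?_)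
      show IsUnit (A J₀)
      rw [hAJ₀]; exact isUnit_one
    obtain ⟨t, ht, hsub⟩ := Metric.mem_nhds_iff.1 hmem
    refine ⟨t / 2, by positivity, fun Jx hJx => hsub ?_⟩
    rw [mem_ball, dist_eq_norm]; linarith
  -- ### homogeneity
  have hhom : ∀ Jx v (r : ℝ), E Jx (r • v) = r • E Jx v := by
    intro Jx v r
    simp only [hE, map_smul]
    rw [hP_real, map_smul, map_smul]
  refine ⟨E, G₁, G₂, t₀, ht₀, ?_, ?_, ?_, hhom, ?_⟩
  · -- ### `G₂` is injective
    refine (injective_iff_map_eq_zero G₂).2 fun x hx => ?_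
    -- the vector `ψ⁻¹ (0, conj (m x))` is horizontal, hence zero
    have h1 : ((conj (m x)).re • ((0, 1) : ℂ × ℂ) + (conj (m x)).im • J₀ (0, 1)).2 = 0 := by
      have := congrArg Prod.snd (hmodel x)
      rw [hψx0] at this
      simp only [hP, neg_zero, map_zero] at this
      rw [hψsymm] at this
      rw [this]; exact hx
    obtain ⟨hre, him⟩ := eq_zero_of_horizontal J₀ hJ₀ hH h1
    have hmx : m x = 0 := by
      apply Complex.ext
      · simpa using hre
      · have : -(m x).im = 0 := by simpa using him
        simpa using this
    have : ψ (x, 0) = 0 := by rw [hψx0, hmx]; rfl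
    have h2 : ((x, 0) : ℂ × ℂ) = 0 := by simpa using this
    simpa using congrArg Prod.fst h2
  · -- ### transversality
    intro Jx hJx hJx2 L c₀ hL hc₀ hmem
    obtain ⟨c, hc⟩ := hmem
    have hU := hunit Jx hJx
    -- `ψ ∘ A ∘ L` is complex-linear
    set f : ℂ →ₗ[ℝ] (ℂ × ℂ) := ((ψ : (ℂ × ℂ) →L[ℝ] (ℂ × ℂ)) : (ℂ × ℂ) →ₗ[ℝ] (ℂ × ℂ)) ∘ₗ
      ((A Jx : (ℂ × ℂ) →L[ℝ] (ℂ × ℂ)) : (ℂ × ℂ) →ₗ[ℝ] (ℂ × ℂ)) ∘ₗ (L : ℂ →ₗ[ℝ] ℂ × ℂ) with hf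
    have hfapp : ∀ c, f c = ψ (A Jx (L c)) := fun c => rfl
    have hfI : ∀ c : ℂ, f (I * c) = I • f c := by
      intro c; rw [hfapp, hfapp, hL, hcomm Jx hJx2, hψJ]
    have hflin : ∀ c, f c = c • f 1 := apply_eq_smul_apply_one hfI
    -- apply `ψ ∘ A` to the relation `L c = E (L c₀)`
    have hkey : P (f c₀) = f c := by
      have h1 : A Jx (E Jx (L c₀)) = ψ.symm (P (ψ (A Jx (L c₀)))) := by
        simp only [hE]
        change (A Jx * Ring.inverse (A Jx)) (ψ.symm (P (ψ (A Jx (L c₀))))) = _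
        rw [Ring.mul_inverse_cancel _ hU]; rfl
      have h2 : ψ (A Jx (E Jx (L c₀))) = P (ψ (A Jx (L c₀))) := by
        rw [h1, ContinuousLinearEquiv.apply_symm_apply]
      rw [hfapp, hfapp, ← h2]
      congr 1
      exact congrArg (A Jx) hc.symm
    rw [hflin c₀, hflin c, hP_smul] at hkey
    -- `c₀ ≠ 0`
    have hc₀' : c₀ ≠ 0 := by rintro rfl; exact hc₀ (by rw [map_zero])
    have hu : f 1 = 0 := by
      refine eq_zero_of_perp_eq_smul (f 1) (c / conj c₀) ?_
      simp only [hP] at hkey ⊢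
      rw [div_eq_mul_inv, mul_comm, mul_smul, ← hkey, smul_smul, inv_mul_cancel₀
        ((map_ne_zero _).2 hc₀'), one_smul]
    -- hence `L c₀ = 0`
    have h3 : f c₀ = 0 := by rw [hflin c₀, hu, smul_zero]
    rw [hfapp] at h3
    have h4 : A Jx (L c₀) = 0 := by simpa using h3
    have h5 : L c₀ = 0 := by
      have h6 : (Ring.inverse (A Jx) * A Jx) (L c₀) = 0 := by
        change Ring.inverse (A Jx) (A Jx (L c₀)) = 0
        rw [h4, map_zero]
      rw [Ring.inverse_mul_cancel _ hU] at h6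
      exact h6
    exact hc₀ h5
  · -- ### continuity
    have hP_cont : Continuous P := by
      simp only [hP]
      exact (continuous_conj.comp continuous_snd).neg.prodMk (continuous_conj.comp continuous_fst)
    have h1 : ContinuousOn (fun p : ((ℂ × ℂ) →L[ℝ] (ℂ × ℂ)) × (ℂ × ℂ) => A p.1 p.2)
        (closedBall J₀ t₀ ×ˢ univ) :=
      ((hAc.comp continuous_fst).continuousOn).clm_apply continuous_snd.continuousOn
    have h2 : ContinuousOn (fun p : ((ℂ × ℂ) →L[ℝ] (ℂ × ℂ)) × (ℂ × ℂ) => ψ.symm (P (ψ (A p.1 p.2))))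
        (closedBall J₀ t₀ ×ˢ univ) :=
      ψ.symm.continuous.comp_continuousOn (hP_cont.comp_continuousOn (ψ.continuous.comp_continuousOn h1))
    have h3 : ContinuousOn (fun p : ((ℂ × ℂ) →L[ℝ] (ℂ × ℂ)) × (ℂ × ℂ) => Ring.inverse (A p.1))
        (closedBall J₀ t₀ ×ˢ univ) := by
      intro p hp
      have hU := hunit p.1 (by simpa [dist_eq_norm] using hp.1)
      obtain ⟨u, hu⟩ := hU
      have hca : ContinuousAt Ring.inverse (A p.1) := by rw [← hu]; exact NormedRing.inverse_continuousAt u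
      have h' : ContinuousAt (fun p : ((ℂ × ℂ) →L[ℝ] (ℂ × ℂ)) × (ℂ × ℂ) => Ring.inverse (A p.1)) p :=
        ContinuousAt.comp (f := fun p : ((ℂ × ℂ) →L[ℝ] (ℂ × ℂ)) × (ℂ × ℂ) => A p.1) hca
          (hAc.comp continuous_fst).continuousAt
      exact h'.continuousWithinAt
    exact h3.clm_apply h2
  · -- ### the model estimate, by compactness
    intro ε hε
    set K : Set (((ℂ × ℂ) →L[ℝ] (ℂ × ℂ)) × (ℂ × ℂ)) :=
      closedBall J₀ t₀ ×ˢ ((sphere (0 : ℂ) 1) ×ˢ closedBall (0 : ℂ) 1) with hK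
    have hKc : IsCompact K :=
      (isCompact_closedBall J₀ t₀).prod ((isCompact_sphere 0 1).prod (isCompact_closedBall 0 1))
    have hKsub : K ⊆ closedBall J₀ t₀ ×ˢ univ := fun p hp => ⟨hp.1, mem_univ _⟩
    set D : ((ℂ × ℂ) →L[ℝ] (ℂ × ℂ)) × (ℂ × ℂ) → ℂ × ℂ := fun p => E p.1 p.2 - (G₁ p.2.1, G₂ p.2.1)
      with hD
    have hDc : ContinuousOn D K := by
      refine (ContinuousOn.mono ?_ hKsub)
      refine ContinuousOn.sub ?_ ?_
      · -- continuity of `E`, proved above (re-derive from the packaged statement)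
        have hP_cont : Continuous P := by
          simp only [hP]
          exact (continuous_conj.comp continuous_snd).neg.prodMk (continuous_conj.comp continuous_fst)
        have h1 : ContinuousOn (fun p : ((ℂ × ℂ) →L[ℝ] (ℂ × ℂ)) × (ℂ × ℂ) => A p.1 p.2)
            (closedBall J₀ t₀ ×ˢ univ) :=
          ((hAc.comp continuous_fst).continuousOn).clm_apply continuous_snd.continuousOn
        have h2 : ContinuousOn (fun p : ((ℂ × ℂ) →L[ℝ] (ℂ × ℂ)) × (ℂ × ℂ) =>
            ψ.symm (P (ψ (A p.1 p.2)))) (closedBall J₀ t₀ ×ˢ univ) :=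
          ψ.symm.continuous.comp_continuousOn
            (hP_cont.comp_continuousOn (ψ.continuous.comp_continuousOn h1))
        have h3 : ContinuousOn (fun p : ((ℂ × ℂ) →L[ℝ] (ℂ × ℂ)) × (ℂ × ℂ) => Ring.inverse (A p.1))
            (closedBall J₀ t₀ ×ˢ univ) := by
          intro p hp
          obtain ⟨u, hu⟩ := hunit p.1 (by simpa [dist_eq_norm] using hp.1)
          have hca : ContinuousAt Ring.inverse (A p.1) := by
            rw [← hu]; exact NormedRing.inverse_continuousAt u
          have h' : ContinuousAt (fun p : ((ℂ × ℂ) →L[ℝ] (ℂ × ℂ)) × (ℂ × ℂ) => Ring.inverse (A p.1)) p :=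
            ContinuousAt.comp (f := fun p : ((ℂ × ℂ) →L[ℝ] (ℂ × ℂ)) × (ℂ × ℂ) => A p.1) hca
              (hAc.comp continuous_fst).continuousAt
          exact h'.continuousWithinAt
        exact h3.clm_apply h2
      · exact ((G₁.continuous.prodMk G₂.continuous).comp (continuous_fst.comp continuous_snd)).continuousOn
    -- `D` vanishes at `(J₀, (v₁, 0))`
    have hD0 : ∀ x : ℂ, D (J₀, (x, 0)) = 0 := by
      intro x
      simp only [hD, hE, hAJ₀, Ring.inverse_one]
      change ψ.symm (P (ψ (x, 0))) - (G₁ x, G₂ x) = 0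
      rw [hmodel x, sub_self]
    -- uniform continuity on `K`
    have huc := hKc.uniformContinuousOn_of_continuous hDc
    rw [Metric.uniformContinuousOn_iff] at huc
    obtain ⟨δ₁, hδ₁, hδ₁c⟩ := huc ε hε
    set δ : ℝ := min (δ₁ / 2) (min t₀ 1) with hδ
    have hδpos : 0 < δ := lt_min (by positivity) (lt_min ht₀ one_pos)
    have hδ₁' : δ < δ₁ := by
      have : δ ≤ δ₁ / 2 := min_le_left _ _; linarith
    have hδt₀ : δ ≤ t₀ := (min_le_right _ _).trans (min_le_left _ _)
    have hδ1 : δ ≤ 1 := (min_le_right _ _).trans (min_le_right _ _)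
    refine ⟨δ, hδpos, fun Jx hJx v hv => ?_⟩
    -- normalise the first component
    rcases eq_or_ne v.1 0 with hv0 | hv0
    · have hv2 : v.2 = 0 := by
        have : ‖v.2‖ ≤ 0 := by simpa [hv0] using hv
        exact norm_le_zero_iff.1 this
      have hvz : v = 0 := Prod.ext hv0 hv2
      have hE0 : E Jx 0 = 0 := by simpa using hhom Jx 0 0
      rw [hvz, hE0]
      simp
    · have hr : 0 < ‖v.1‖ := norm_pos_iff.2 hv0
      set u : ℂ × ℂ := (‖v.1‖⁻¹ : ℝ) • v with hu
      have hu1 : ‖u.1‖ = 1 := by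
        simp only [hu, Prod.smul_fst, norm_smul, norm_inv, Real.norm_of_nonneg hr.le]
        exact inv_mul_cancel₀ hr.ne'
      have hu2 : ‖u.2‖ ≤ δ := by
        simp only [hu, Prod.smul_snd, norm_smul, norm_inv, Real.norm_of_nonneg hr.le]
        rw [inv_mul_le_iff₀ hr]; linarith [mul_comm δ ‖v.1‖]
      -- the two points of `K`
      have hpK : (Jx, u) ∈ K := by
        refine ⟨?_, ?_, ?_⟩
        · simpa [dist_eq_norm] using hJx.trans hδt₀
        · simpa using hu1
        · simpa using hu2.trans hδ1
      have hqK : (J₀, ((u.1, 0) : ℂ × ℂ)) ∈ K := by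
        refine ⟨mem_closedBall_self ht₀.le, ?_, ?_⟩
        · simpa using hu1
        · simp
      have hdist : dist (Jx, u) (J₀, ((u.1, 0) : ℂ × ℂ)) < δ₁ := by
        rw [Prod.dist_eq, Prod.dist_eq, dist_eq_norm, dist_self, dist_eq_norm]
        simp only [sub_zero]
        refine max_lt (hJx.trans_lt hδ₁') (max_lt (by simpa using hδ₁) (hu2.trans_lt hδ₁'))
      have hDu : ‖D (Jx, u)‖ < ε := by
        have := hδ₁c _ hpK _ hqK hdist
        rwa [hD0, dist_zero_right] at this
      -- scale back
      have hscale : E Jx v - (G₁ v.1, G₂ v.1) = ‖v.1‖ • D (Jx, u) := by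
        have hv' : v = (‖v.1‖ : ℝ) • u := by
          rw [hu, smul_smul, mul_inv_cancel₀ hr.ne', one_smul]
        simp only [hD]
        conv_lhs => rw [hv']
        rw [hhom, Prod.smul_fst, map_smul, map_smul, smul_sub]
        rfl
      rw [hscale, norm_smul, Real.norm_of_nonneg hr.le, mul_comm]
      exact mul_le_mul_of_nonneg_right hDu.le hr.le

/-! ### Real-linear maps preserve the absolute winding number -/

/-- An injective real-linear `z ↦ α z + β z̄` has `|α| ≠ |β|`. [folklore] -/
theorem norm_ne_of_injective {α β : ℂ} (h : Function.Injective fun z : ℂ => α * z + β * conj z) :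
    ‖α‖ ≠ ‖β‖ := by
  intro heq
  rcases eq_or_ne β 0 with hβ | hβ
  · have hα : α = 0 := by rwa [hβ, norm_zero, norm_eq_zero] at heq
    have := @h 1 0 (by simp [hα, hβ])
    exact one_ne_zero this
  · have hα : α ≠ 0 := by
      intro hα; rw [hα, norm_zero, eq_comm, norm_eq_zero] at heq; exact hβ heq
    -- a square root of the unit complex number `-β/α`
    obtain ⟨z, hz⟩ := IsAlgClosed.exists_pow_nat_eq (-β / α) two_pos
    have hu : ‖-β / α‖ = 1 := by rw [norm_div, norm_neg, ← heq, div_self (norm_ne_zero_iff.2 hα)]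
    have hz1 : ‖z‖ = 1 := by
      have : ‖z‖ ^ 2 = 1 := by rw [← norm_pow, hz, hu]
      nlinarith [norm_nonneg z]
    have hz0 : z ≠ 0 := fun h0 => by rw [h0, norm_zero] at hz1; exact zero_ne_one hz1
    have hzz : z * conj z = 1 := by
      rw [mul_conj, normSq_eq_norm_sq, hz1, one_pow, ofReal_one]
    -- `α z + β conj z = conj z (α z² + β) = 0`
    have hval : α * z + β * conj z = 0 := by
      have : α * z + β * conj z = conj z * (α * z ^ 2 + β) := by
        linear_combination (-(α * z)) * hzz
      rw [this, hz, mul_div_cancel₀ _ hα]; ring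
    have := @h z 0 (by simp [hval])
    exact hz0 this

/-- **Real-linear injections preserve the absolute winding number.** [folklore] -/
theorem natAbs_wind_comp_realLinear (R : ℂ →L[ℝ] ℂ) (hR : Function.Injective R) {γ : ℝ → ℂ}
    (hγ : IsNonvanishingLoop γ) : (wind fun t => R (γ t)).natAbs = (wind γ).natAbs := by
  set α : ℂ := (R 1 - I * R I) / 2 with hα
  set β : ℂ := (R 1 + I * R I) / 2 with hβ
  -- every real-linear map of `ℂ` has the form `z ↦ α z + β z̄`
  have hRz : ∀ z, R z = α * z + β * conj z := by
    intro z
    have key : ∀ x y : ℝ, R ((x : ℂ) + (y : ℂ) * I) =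
        α * ((x : ℂ) + (y : ℂ) * I) + β * ((x : ℂ) - (y : ℂ) * I) := by
      intro x y
      have : ((x : ℂ) + (y : ℂ) * I) = (x : ℝ) • (1 : ℂ) + (y : ℝ) • I := by
        rw [real_smul, real_smul, mul_one]
      conv_lhs => rw [this, map_add, map_smul, map_smul, real_smul, real_smul]
      rw [hα, hβ]
      linear_combination ((y : ℂ) * R I) * I_sq
    have ec : conj z = (z.re : ℂ) - (z.im : ℂ) * I := Complex.ext (by simp) (by simp)
    have := key z.re z.im
    rwa [re_add_im, ← ec] at this
  have hinj : Function.Injective fun z : ℂ => α * z + β * conj z := by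
    have : (fun z : ℂ => α * z + β * conj z) = R := funext fun z => (hRz z).symm
    rw [this]; exact hR
  have hne := norm_ne_of_injective hinj
  have hRγ : (fun t => R (γ t)) = fun t => α * γ t + β * conj (γ t) := funext fun t => hRz _
  rw [hRγ]
  rcases lt_or_gt_of_ne hne with hlt | hlt
  · -- `|α| < |β|`: Rouché against `β conj γ`
    have hβ0 : β ≠ 0 := by
      intro h0; rw [h0, norm_zero] at hlt; exact not_lt.2 (norm_nonneg α) hlt
    have hg : IsNonvanishingLoop fun t => β * conj (γ t) := by
      refine ⟨continuousOn_const.mul (continuous_conj.comp_continuousOn hγ.continuousOn),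
        fun t ht => mul_ne_zero hβ0 ((map_ne_zero _).2 (hγ.ne_zero t ht)), ?_⟩
      simp only [hγ.eq_endpoints]
    have h1 : wind (fun t => α * γ t + β * conj (γ t)) = wind fun t => β * conj (γ t) := by
      refine wind_eq_of_norm_sub_lt ?_ ?_ hg fun t ht => ?_
      · exact (continuousOn_const.mul hγ.continuousOn).add
          (continuousOn_const.mul (continuous_conj.comp_continuousOn hγ.continuousOn))
      · simp only [hγ.eq_endpoints]
      · rw [add_sub_cancel_right, norm_mul, norm_mul, Complex.norm_conj]
        exact mul_lt_mul_of_pos_right hlt (norm_pos_iff.2 (hγ.ne_zero t ht))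
    have h2 : wind (fun t => β * conj (γ t)) = -wind γ := by
      have hc : IsNonvanishingLoop fun t => conj (γ t) :=
        ⟨continuous_conj.comp_continuousOn hγ.continuousOn,
          fun t ht => (map_ne_zero _).2 (hγ.ne_zero t ht), by simp only [hγ.eq_endpoints]⟩
      have := wind_mul (IsNonvanishingLoop.const hβ0) hc
      rw [this, wind_const, zero_add, wind_conj hγ]
    rw [h1, h2, Int.natAbs_neg]
  · -- `|β| < |α|`: Rouché against `α γ`
    have hα0 : α ≠ 0 := by
      intro h0; rw [h0, norm_zero] at hlt; exact not_lt.2 (norm_nonneg β) hlt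
    have hg : IsNonvanishingLoop fun t => α * γ t := (IsNonvanishingLoop.const hα0).mul hγ
    have h1 : wind (fun t => α * γ t + β * conj (γ t)) = wind fun t => α * γ t := by
      refine wind_eq_of_norm_sub_lt ?_ ?_ hg fun t ht => ?_
      · exact (continuousOn_const.mul hγ.continuousOn).add
          (continuousOn_const.mul (continuous_conj.comp_continuousOn hγ.continuousOn))
      · simp only [hγ.eq_endpoints]
      · rw [add_sub_cancel_left, norm_mul, norm_mul, Complex.norm_conj]
        exact mul_lt_mul_of_pos_right hlt (norm_pos_iff.2 (hγ.ne_zero t ht))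
    have h2 : wind (fun t => α * γ t) = wind γ := by
      rw [wind_mul (IsNonvanishingLoop.const hα0) hγ, wind_const, zero_add]
    rw [h1, h2]

end CuspDoublePoints

end Literature.Geometry.Symplectic
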